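import Literature.AlgebraicGeometry.Motives.AbelianVarietyPoincareOrthogonal
import Literature.AlgebraicGeometry.Motives.AbelianVarietyWeilDivisor
import Literature.AlgebraicGeometry.Motives.SemicontinuityGrothendieckComplexProofs
import HarnessLib

/-!
# `K(Θ) = {P ; t_P^* Θ ∼ Θ}` is a finite subgroup for `Θ` ample (Mumford §6, Application 1)

For an abelian variety `A` over a field `K` and a Cartier divisor `Θ`, the rational points `P` with
`t_P^* Θ ∼ Θ` — equivalently `D_P = t_P^* Θ - Θ ∼ 0` (`AbelianVariety.weilDiv`,
`Motives/AbelianVarietyWeilDivisor`) — form a subgroup `K(Θ) ≤ A(K)` (`AbelianVariety.KTheta`; a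
subgroup by the theorem of the square, `weilDiv_mul_linEquiv`). This is Mumford's `K(L)` (rational
points) for `L = 𝒪(Θ)` (*Abelian Varieties*, §6, Application 1 and Definition p. 60; §8), the kernel
of `φ_Θ : A(K) → Pic(A)`.

* `finite_KTheta` — **for `Θ` ample and `K` algebraically closed, `K(Θ)` is finite** (Mumford §6,
  Application 1, p. 60: "`K(L)` is finite" for `L` ample; Milne 1986, Prop. 9.2 (⇒)); in the tree
  this is `finite_preimage_orth` of `Motives/AbelianVarietyPoincareOrthogonal` at `i = 𝟙` (the seesaw
  facts and the cubical structure being the theorems `seesaw_isClosed_trivialLocus_holds`,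
  `seesaw_exists_linEquiv_classPullback_of_pseudoCoherent_general cechComplex_pseudoCoherent_general_holds`
  and `cubicalStructure_linEquiv_holds`), transported from closed points to rational points
  (`eq_of_left_closedPoint_eq`);
* `pow_natCard_KTheta_eq_one` — hence `P ^ #K(Θ) = 1` for `P ∈ K(Θ)`;
* `pow_prime_pow_eq_one_of_pow_eq_one` — an element of `p`-power order killed by `m > 0` is
  killed by `p ^ m` (elementary), so that **`p^{#K(Θ)}` kills every `p`-power torsion point of
  `K(Θ)`**: the uniform bound on the radicals of the level Weil pairings `ē_{pᵏ}^Θ` (whose radical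
  in `Q` lies in `K(Θ) ∩ A[pᵏ]`, Lang VII §2 Prop. 4, `Motives/AbelianVarietyWeilPairingLevel`).

Everything is proved; no named facts (D-0026). Towards the named fact
`Literature.NumberTheory.DiophantineGeometry.weilPairing_rationalTateModule`.

## References

* [MumfordAV1970] D. Mumford, *Abelian Varieties* (1970), §6, Application 1 and the Definition of
  `K(L)` (p. 60); §8.
* [Milne1986AbelianVarieties] J. S. Milne, *Abelian varieties*, in Cornell–Silverman (1986),
  Prop. 9.2.
-/

universe u

open CategoryTheory CategoryTheory.Limits AlgebraicGeometry MonoidalCategory CartesianMonoidalCategory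

noncomputable section

namespace Literature.AlgebraicGeometry.Motives

open scoped MonObj
open RatFn

/-! ### An elementary group lemma -/

/-- An element of `p`-power order (`x ^ p ^ k = 1`) killed by some `m > 0` is killed by `p ^ m`:
its order is `p ^ j` with `p ^ j ∣ m`, so `j < p ^ j ≤ m`. [folklore] -/
theorem pow_prime_pow_eq_one_of_pow_eq_one {G : Type*} [Monoid G] {x : G} {p : ℕ} (hp : p.Prime)
    {k m : ℕ} (hm : 0 < m) (hk : x ^ p ^ k = 1) (hxm : x ^ m = 1) : x ^ p ^ m = 1 := by
  have h1 : orderOf x ∣ p ^ k := orderOf_dvd_of_pow_eq_one hk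
  obtain ⟨j, -, hj⟩ := (Nat.dvd_prime_pow hp).1 h1
  have h2 : p ^ j ∣ m := hj ▸ orderOf_dvd_of_pow_eq_one hxm
  have h3 : j ≤ m := ((j.lt_pow_self hp.one_lt).le).trans (Nat.le_of_dvd hm h2)
  obtain ⟨c, hc⟩ := pow_dvd_pow p h3
  rw [hc, pow_mul, ← hj, pow_orderOf_eq_one, one_pow]

namespace AbelianVariety

variable {K : Type u} [Field K] (A : AbelianVariety K)

/-! ### The subgroup `K(Θ)` -/

/-- **`K(Θ) = {P ∈ A(K) ; t_P^* Θ ∼ Θ}`**, the kernel of `φ_Θ : P ↦ [t_P^* Θ - Θ]` on rational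
points (Mumford, *Abelian Varieties*, §6, Definition p. 60, and §8: `K(L)`): a subgroup of `A(K)` by
the theorem of the square (`weilDiv_mul_linEquiv`). [cite: MumfordAV1970, §6 Definition (p. 60) and §8] -/
def KTheta (Θ : CartierDivisor A.X.left) : Subgroup (A.Points K) where
  carrier := {P | (A.weilDiv Θ P).LinEquiv 0}
  one_mem' := A.weilDiv_one_linEquiv_zero Θ
  mul_mem' {P Q} hP hQ :=
    (A.weilDiv_mul_linEquiv Θ P Q).trans
      ((CartierDivisor.LinEquiv.add hP hQ).trans (CartierDivisor.zero_add_sameDivisor 0).linEquiv)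
  inv_mem' {P} hP := by
    have h1 : (A.weilDiv Θ (P * P⁻¹)).LinEquiv 0 := by
      rw [mul_inv_cancel]; exact A.weilDiv_one_linEquiv_zero Θ
    have h2 := (A.weilDiv_mul_linEquiv Θ P P⁻¹).symm.trans h1
    exact ((CartierDivisor.zero_add_sameDivisor _).linEquiv.symm.trans
      (CartierDivisor.LinEquiv.add hP.symm (CartierDivisor.LinEquiv.refl _))).trans h2

/-- Membership in `K(Θ)`: `D_P ∼ 0`. [folklore] -/
theorem mem_KTheta_iff (Θ : CartierDivisor A.X.left) (P : A.Points K) :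
    P ∈ A.KTheta Θ ↔ (A.weilDiv Θ P).LinEquiv 0 :=
  Iff.rfl

/-- Membership in `K(Θ)`: `t_P^* Θ ∼ Θ`. [folklore] -/
theorem mem_KTheta_iff' (Θ : CartierDivisor A.X.left) (P : A.Points K) :
    P ∈ A.KTheta Θ ↔ (Θ.pullback (A.translation P).left).LinEquiv Θ :=
  ⟨fun h => CartierDivisor.LinEquiv.of_add_neg h, fun h => CartierDivisor.LinEquiv.add_neg h⟩

/-- The divisor `ψ(P) = (t_P^* Θ - Θ)|_Y` of `Motives/AbelianVarietyPoincareOrthogonal` for the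
abelian subvariety `Y = A` (`i = 𝟙`) is `D_P` up to linear equivalence. [folklore] -/
theorem psi_id_linEquiv_weilDiv (Θ : CartierDivisor A.X.left) (P : A.Points K) :
    (psi (𝟙 A) Θ P).LinEquiv (A.weilDiv Θ P) := by
  unfold psi weilDiv
  have e : Hom.toSchemeHom (𝟙 A) = 𝟙 A.X.left := rfl
  rw [CartierDivisor.classPullback_congr e]
  refine (CartierDivisor.classPullback_id_linEquiv _).trans ?_
  exact CartierDivisor.LinEquiv.add (Θ.classPullback_linEquiv_pullback _) (CartierDivisor.LinEquiv.refl _)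

/-- **`K(Θ)` is finite for `Θ` ample** over an algebraically closed field (Mumford, *Abelian
Varieties*, §6, Application 1, p. 60: "`K(L)` is finite"; Milne 1986, Prop. 9.2): the tree's
`finite_preimage_orth` (`Motives/AbelianVarietyPoincareOrthogonal`, at `i = 𝟙`: the closed subgroup
`Y^⊥ ∩ Y` of points with `(t_P^* L - L)|_Y ∼ 0` is finite, from the seesaw theorem and the
cubical structure — all theorems of the tree), read on rational points, which are determined by
their closed points (`eq_of_left_closedPoint_eq`). [cite: MumfordAV1970, §6 Application 1 (p. 60)] -/
theorem finite_KTheta [IsAlgClosed K] {Θ : CartierDivisor A.X.left} (hΘ : Θ.IsAmple) :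
    (A.KTheta Θ : Set (A.Points K)).Finite := by
  haveI : IsClosedImmersion (Hom.toSchemeHom (𝟙 A)) := by
    change IsClosedImmersion (𝟙 A.X.left); infer_instance
  have hfin := finite_preimage_orth (𝟙 A) Θ seesaw_isClosed_trivialLocus_holds
    (seesaw_exists_linEquiv_classPullback_of_pseudoCoherent_general
      cechComplex_pseudoCoherent_general_holds)
    A.cubicalStructure_linEquiv_holds hΘ
  refine Set.Finite.of_finite_image (f := fun P : A.Points K => P.left (IsLocalRing.closedPoint K))
    (hfin.subset ?_) (fun P _ Q _ h => A.eq_of_left_closedPoint_eq P Q h)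
  rintro _ ⟨P, hP, rfl⟩
  change Hom.toSchemeHom (𝟙 A) (P.left (IsLocalRing.closedPoint K)) ∈ orth (𝟙 A) Θ
  have e : Hom.toSchemeHom (𝟙 A) (P.left (IsLocalRing.closedPoint K)) =
      P.left (IsLocalRing.closedPoint K) := rfl
  rw [e, left_closedPoint_mem_orth_iff]
  exact (A.psi_id_linEquiv_weilDiv Θ P).trans hP

/-- **`P ^ #K(Θ) = 1` for every `P ∈ K(Θ)`** (Lagrange; when `K(Θ)` is infinite `Nat.card = 0`
and the statement is trivial). [folklore] -/
theorem pow_natCard_KTheta_eq_one {Θ : CartierDivisor A.X.left} {P : A.Points K}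
    (hP : P ∈ A.KTheta Θ) : P ^ Nat.card (A.KTheta Θ) = 1 :=
  congrArg Subtype.val (pow_card_eq_one' (G := A.KTheta Θ) (x := ⟨P, hP⟩))

/-- `#K(Θ) > 0` for `Θ` ample over `K = K̄`. [folklore] -/
theorem natCard_KTheta_pos [IsAlgClosed K] {Θ : CartierDivisor A.X.left} (hΘ : Θ.IsAmple) :
    0 < Nat.card (A.KTheta Θ) := by
  haveI : Finite (A.KTheta Θ) := (A.finite_KTheta hΘ).to_subtype
  exact Nat.card_pos

/-- **The uniform bound on `p`-power torsion in `K(Θ)`**: for `Θ` ample over `K = K̄` and a prime `p`,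
every `P ∈ K(Θ)` of `p`-power order satisfies `P ^ p ^ #K(Θ) = 1`. This is the bound used for the
radicals of the level Weil pairings `ē_{pᵏ}^Θ` (their radical in `Q` lies in `K(Θ) ∩ A[pᵏ]`,
Lang VII §2, Prop. 4). [folklore] -/
theorem pow_prime_pow_natCard_KTheta_eq_one [IsAlgClosed K] {Θ : CartierDivisor A.X.left}
    (hΘ : Θ.IsAmple) {p : ℕ} (hp : p.Prime) {k : ℕ} {P : A.Points K} (hk : P ^ p ^ k = 1)
    (hP : P ∈ A.KTheta Θ) : P ^ p ^ Nat.card (A.KTheta Θ) = 1 :=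
  pow_prime_pow_eq_one_of_pow_eq_one hp (A.natCard_KTheta_pos hΘ) hk
    (A.pow_natCard_KTheta_eq_one hP)

end AbelianVariety

end Literature.AlgebraicGeometry.Motives
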